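import Mathlib
import HarnessLib
import Summits.HubbardSuperconductivity.HubbardSuperconductivity.Theorems.KLProgrammeKLRegimeTwoVolumeTowerTruncOfPartsS
import Summits.HubbardSuperconductivity.HubbardSuperconductivity.Theorems.KLProgrammeKLRegimeTwoVolumeTowerSmallnessOfLaws

/-!
# Route `KLProgramme` — crux K3, VL child `KLRegimeVolumeLimitV17F2` (stmt-HubbardSuperconductivity-20440), skeleton «cauchy» v11: THE SOURCE-RESCALED DATA
# PACKAGE FROM THE SCALE LAWS (assembler step S5∘S6 of ASSEMBLY-DESIGN-g15; seat hubbard-kl-k3c4-p1 g15; `--supports` 20440)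

`…TowerTruncOfPartsS.towerDataTS_of_partsD` (p627777) takes the per-scale radii, raw budgets, series and the frozen smallness (H2)–(H3) as inputs;
`…TowerSmallnessOfLaws.towerSmallness_of_laws` produces exactly those from the doors' scale laws and one smallness inequality per scale.  This file is
the composition: **`towerDataTS_of_laws`** — `Nonempty (TowerDataTS β U μ t)` from (constants + laws + ONE smallness inequality per scale) + the profile
majorants `NV j m ≤ A_j q_j^m` (`…TowerBudgetGeom`) + the three data bundles (H5) eventually in `L` (`…TowerVolumeDataTSOfReadout` per volume, `TowerCrossData`
from p3's / k3c4-p2's doors, with `κ′ := κ`, `aW′ := aW`, `sW′ := sW`) + (H4) rates + the UNSCALED base bundle of the W4 chain (verbatim).  No radius, no series,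
no `TowerScaleSmall` is left to the caller.

Proofs only; no definition.  Honest framing: a conditional constructor; nothing here asserts the data, the stub, K3 or superconductivity.
[cite: BenfattoGiulianiMastropietro2006, §2.7-§2.9 and §3]
-/

noncomputable section

namespace Summit.HubbardSuperconductivity.HubbardSuperconductivity.Theorems.TwoVolumeSource

set_option linter.dupNamespace false -- summit = problem name (single-conjunct summit), D-0017

open Finset Filter Topology Literature.MathematicalPhysics.QuantumLattice GrassmannAlgebra Literature.Probability.LatticeModels
  Literature.Probability.LatticeModels.BattleFederbush
open Summit.HubbardSuperconductivity.HubbardSuperconductivity.Theorems.KLRegimeSplit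
open Summit.HubbardSuperconductivity.HubbardSuperconductivity.Theorems.KLProgrammeLegKernels
open Summit.HubbardSuperconductivity.HubbardSuperconductivity.Theorems.TwoPointAssembly
open Summit.HubbardSuperconductivity.HubbardSuperconductivity.Theorems.EngineV8
open Summit.HubbardSuperconductivity.HubbardSuperconductivity.Theorems.TwoVolumeDefect

set_option maxHeartbeats 800000 in -- one large constructor application
/-- **`TowerDataTS β U μ t` FROM THE SCALE LAWS** (see the module docstring). [folklore: composition; cite: BenfattoGiulianiMastropietro2006, §2.7-§2.9 and §3] -/
theorem towerDataTS_of_laws (β U μ : ℝ) (hβ : 0 < β) {t : ℝ} (ht0 : 0 ≤ t) (ht1 : t ≤ 1) (Mth : ℕ → ℕ → ℕ)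
    (hMth : ∀ L b M, Mth L b ≤ M → 0 < imagTimeWeight β M)
    -- constants per scale and their laws
    (Λ ΛT κ κf aW sW eW' cW cRb cCb δb A q : ℕ → ℝ) (NV : ℕ → ℕ → ℝ) (sE cR cC δ : ℕ → ℕ → ℝ) (kf cW₀ δb₀ r₀ : ℝ)
    (hΛ : ∀ j, 0 < Λ j) (hΛmono : ∀ j, Λ (j + 1) ≤ Λ j) (hΛT : ∀ j, Λ j ≤ ΛT j)
    (hκ : ∀ j, 0 < κ j) (hκmono : ∀ j, κ (j + 1) ≤ κ j) (hκfge : ∀ j, κ j ≤ κf j) (hκf : ∀ j, κf j ≤ kf * κ j) (hkf : 1 ≤ kf)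
    (haW : ∀ j, 0 ≤ aW j) (hsW : ∀ j, 0 ≤ sW j) (heW' : ∀ j, 0 ≤ eW' j) (hcW1 : ∀ j, 1 ≤ cW j) (hcW : ∀ j, cW j ≤ cW₀)
    (hcRb : ∀ j, 0 ≤ cRb j) (hcCb : ∀ j, 0 ≤ cCb j) (hδb0 : ∀ j, 0 ≤ δb j) (hδb : ∀ j, δb j ≤ δb₀)
    (hr₀ : 8 * Real.exp 2 * (kf + 1) * (cW₀ + δb₀ + 1) ≤ r₀)
    -- the profile majorants and the two smallness inequalities per scale
    (hq : ∀ j, q j = 1 / (2 * (Real.exp 2 * (κ j + r₀ * κ j)) ^ 2))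
    (hNV0 : ∀ j m, 0 ≤ NV j m) (hA0 : ∀ j, 0 ≤ A j) (hNV : ∀ j m, NV j m ≤ A j * q j ^ m)
    (hS : ∀ j, j < nScales β → Real.exp 1 * (aW j + cRb j + cCb j + 1) * (42 * cW j + 4 * δb j + 8 * Real.exp 1) * A j ≤ κ j ^ 2 / 2)
    (hS' : ∀ j, j + 1 < nScales β →
      Real.exp 1 * (aW (j + 1) + cRb (j + 1) + cCb (j + 1) + 1) * (42 * cW (j + 1) + 4 * δb (j + 1) + 8 * Real.exp 1) * (4 * Real.exp 1 * A j) ≤ κ (j + 1) ^ 2 / 2)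
    -- (H4) the mismatch rates
    (hmis : ∀ j L, 0 ≤ sE j L ∧ 0 ≤ cR j L ∧ 0 ≤ cC j L ∧ 0 ≤ δ j L ∧ cR j L ≤ cRb j ∧ cC j L ≤ cCb j ∧ δ j L ≤ δb j)
    (hmis0 : ∀ j, Tendsto (sE j) atTop (𝓝 0) ∧ Tendsto (cR j) atTop (𝓝 0) ∧ Tendsto (cC j) atTop (𝓝 0) ∧ Tendsto (δ j) atTop (𝓝 0))
    -- (H5) the three bundles, eventually in `L`
    (hdata : ∀ᶠ L in atTop, ∀ (b M : ℕ) [NeZero L] [NeZero (b * L)] [NeZero M], Mth L b ≤ M →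
      TowerVolumeDataTS L M β U μ (klFlowFrameU L M β U μ (nScales β + 1)) (nScales β) (imagTimeWeight β M) t Λ κ aW sW NV ∧
      TowerVolumeDataTS (b * L) M β U μ (klFlowFrameU (b * L) M β U μ (nScales β + 1)) (nScales β) (imagTimeWeight β M) t Λ κ aW sW NV ∧
      TowerCrossData L b M β μ (klFlowFrameU L M β U μ (nScales β + 1)) (klFlowFrameU (b * L) M β U μ (nScales β + 1)) (nScales β) (imagTimeWeight β M)
      Λ κ aW sW eW' ΛT cW κf (fun j => sE j L) (fun j => cR j L) (fun j => cC j L) (fun j => δ j L))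
    -- the base-transfer data of `…TowerBase`
    {ΛgT cgW Λg δgb : ℝ} (hgΛT : 0 < ΛgT) (hcgW : 0 ≤ cgW) (hΛg : 0 < Λg) (NG : ℕ → ℝ) (hNG0 : ∀ k, 0 ≤ NG k)
    (δg : ℕ → ℝ) (hgδ : ∀ L, 0 ≤ δg L ∧ δg L ≤ δgb) (hgδ0 : Tendsto δg atTop (𝓝 0))
    (hdataT : ∀ᶠ L in atTop, ∀ (b M : ℕ) [NeZero L] [NeZero (b * L)] [NeZero M], Mth L b ≤ M →
      (∀ x : SrcLabel (b * L) M 0, ∑ y, ‖klBaseTransfer (b * L) M β μ (klFlowFrameU L M β U μ (nScales β + 1)) x y‖ * (1 + ΛgT * (Torus.tnorm (x.1.1.2 - y.1.1.1.2) : ℝ)) ≤ cgW) ∧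
      (∀ y : GridLeg (GridPoint (b * L) (klGridN M)) × Fin 2, ∑ x, ‖klBaseTransfer (b * L) M β μ (klFlowFrameU L M β U μ (nScales β + 1)) x y‖ * (1 + ΛgT * (Torus.tnorm (x.1.1.2 - y.1.1.1.2) : ℝ)) ≤ cgW) ∧
      (∀ (δ' β' β₁ : Fin 2 → Fin b) (xbar : SrcLabel L M 0) (y : GridLeg (GridPoint L (klGridN M)) × Fin 2),
        ‖klBaseTransfer (b * L) M β μ (klFlowFrameU L M β U μ (nScales β + 1)) ((klBlockEquivD L b M 0).symm (β' + δ', xbar)) ((klGridBlockEquivD L b M).symm (β₁ + δ', y))‖ =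
          ‖klBaseTransfer (b * L) M β μ (klFlowFrameU L M β U μ (nScales β + 1)) ((klBlockEquivD L b M 0).symm (β', xbar)) ((klGridBlockEquivD L b M).symm (β₁, y))‖) ∧
      (∀ x, ∑ y, ‖klBaseTransfer (b * L) M β μ (klFlowFrameU (b * L) M β U μ (nScales β + 1)) x y - klBaseTransfer (b * L) M β μ (klFlowFrameU L M β U μ (nScales β + 1)) x y‖ ≤ δg L) ∧
      (∀ y, ∑ x, ‖klBaseTransfer (b * L) M β μ (klFlowFrameU (b * L) M β U μ (nScales β + 1)) x y - klBaseTransfer (b * L) M β μ (klFlowFrameU L M β U μ (nScales β + 1)) x y‖ ≤ δg L) ∧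
      (∀ (k : ℕ) (p : Fin k) (y : GridLeg (GridPoint L (klGridN M))),
        ∑ Y ∈ univ.filter (fun Y : Fin k → GridLeg (GridPoint L (klGridN M)) => Y p = y),
          ‖kernel ℂ (klGridAction L M β U μ (klFlowFrameU L M β U μ (nScales β + 1))) k Y‖ *
            (1 + labelDiam (fun Y₁ Y₂ : GridLeg (GridPoint L (klGridN M)) => Λg * (Torus.tnorm (Y₁.1.1.2 - Y₂.1.1.2) : ℝ)) (univ.image Y)) ≤ imagTimeWeight β M * NG k) ∧
      (∀ (k : ℕ) (p : Fin k) (y : GridLeg (GridPoint (b * L) (klGridN M))),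
        ∑ Y ∈ univ.filter (fun Y : Fin k → GridLeg (GridPoint (b * L) (klGridN M)) => Y p = y),
          ‖kernel ℂ (klGridAction (b * L) M β U μ (klFlowFrameU (b * L) M β U μ (nScales β + 1))) k Y‖ *
            (1 + labelDiam (fun Y₁ Y₂ : GridLeg (GridPoint (b * L) (klGridN M)) => Λg * (Torus.tnorm (Y₁.1.1.2 - Y₂.1.1.2) : ℝ)) (univ.image Y)) ≤ imagTimeWeight β M * NG k))
    -- the grid data, grid scaling
    {κE aC cb κg κg' ρS ρg' ρg₂ ρgf aw al al' mo mo' s s' Θ νW νf νg₂ νD : ℝ}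
    (hκE : 0 < κE) (haC : 0 < aC) (hgκ : 0 < κg) (hgκ' : 0 < κg') (hρS : 0 < ρS) (hgρ' : 0 < ρg') (hgρ₂ : 0 < ρg₂) (hgρf : 0 < ρgf) (haw : 0 < aw)
    (haa : 0 < al' + al) (hm0 : 0 ≤ mo) (hm0' : 0 ≤ mo') (hs0 : 0 ≤ s) (hs'0 : 0 ≤ s') (hΘ0 : 0 ≤ Θ) (hνW0 : 0 ≤ νW) (hνf0 : 0 ≤ νf) (hν₂0 : 0 ≤ νg₂)
    (hθS : Real.exp 1 * (aC + cb) * νW / κE ^ 2 < 1) (hθΘ : Real.exp 1 * aw * Θ / κg' ^ 2 < 1)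
    (hθf : Real.exp 1 * (al' + al + (mo' + mo)) * νf / (κg' + κg) ^ 2 < 1) (hθ₂ : Real.exp 1 * (al' + al + (mo' + mo)) * νg₂ / (κg' + κg + (κg' + κg + (κg' + κg))) ^ 2 < 1)
    (sgE cc eE tT Te : ℕ → ℝ) (D₀ : ℕ)
    (hrate : ∀ L, 0 ≤ sgE L ∧ 0 ≤ cc L ∧ 2 * cc L ≤ cb ∧ 0 < tT L ∧ 0 ≤ Te L)
    (hsE0 : Tendsto sgE atTop (𝓝 0)) (hcc0 : Tendsto cc atTop (𝓝 0)) (heE0 : Tendsto eE atTop (𝓝 0)) (htT0 : Tendsto tT atTop (𝓝 0))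
    (hTe0 : Tendsto Te atTop (𝓝 0))
    (hgdata : ∀ᶠ L in atTop, ∀ (b M : ℕ) [NeZero L] [NeZero (b * L)] [NeZero M], Mth L b ≤ M →
      Nonempty (TowerGridDataD L b M β U μ (klFlowFrameU L M β U μ (nScales β + 1)) (klFlowFrameU (b * L) M β U μ (nScales β + 1)) (imagTimeWeight β M) κE aC κg κg' ρS ρg' ρg₂ ρgf aw al al' mo mo' s s' Θ νW νf νg₂ νD
        (sgE L) (cc L) (eE L) (tT L) (Te L) (Nat.sqrt (L / (4 * nScales β + 7))) ((L / (4 * nScales β + 7)) - Nat.sqrt (L / (4 * nScales β + 7))) D₀))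
 :
    Nonempty (TowerDataTS β U μ t) := by
  have hκf0 : ∀ j, 0 < κf j := fun j => (hκ j).trans_le (hκfge j)
  obtain ⟨ρ₀, NS, ν₀, ν₁, ν₂, ν₃, ν₄, ν₅, νE, ν₆, ν₇, ν₈, hρ₀, hNSnn, hNS0, hNSsucc, hsm⟩ :=
    towerSmallness_of_laws (nScales β) κ κf aW cW cRb cCb δb A q NV kf cW₀ δb₀ r₀ hκ hκmono hκfge hκf hkf haW hcW1 hcW hcRb hcCb hδb0 hδb hr₀ hq hNV0 hA0 hNV
      hS hS'
  exact towerDataTS_of_partsD β U μ hβ ht0 ht1 Mth hMth Λ κ aW sW κ aW sW eW' ΛT cW κf cRb cCb δb ρ₀ κ κ κ κ ν₀ ν₁ ν₂ ν₃ ν₄ ν₅ νE ν₆ ν₇ ν₈ NV NS sE cR cC δ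
    hΛ hΛmono hΛT (fun j => ⟨hκ j, hκ j, hκf0 j⟩) (fun j => ⟨haW j, haW j, hsW j, hsW j, heW' j, zero_le_one.trans (hcW1 j), hδb0 j⟩)
    (fun j => ⟨hρ₀ j, hκ j, hκ j, hκ j, hκ j⟩) hNV0 hNSnn hNS0 hNSsucc hsm hmis hmis0 hdata
    hgΛT hcgW hΛg NG hNG0 δg hgδ hgδ0 hdataT hκE haC hgκ hgκ' hρS hgρ' hgρ₂ hgρf haw haa hm0 hm0' hs0 hs'0 hΘ0 hνW0 hνf0 hν₂0 hθS hθΘ hθf hθ₂ sgE cc eE tT Te D₀ hrate hsE0 hcc0 heE0 htT0 hTe0 hgdata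

end Summit.HubbardSuperconductivity.HubbardSuperconductivity.Theorems.TwoVolumeSource

end
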